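import Summits.BirchSwinnertonDyer.Rank1Residual.Additive.RamifiedSevenGenusTowerAction
import HarnessLib

/-!
# `𝒞₇` genus road, row (GENUS-PORT-A2) block (U1a), part 2: the `η₁`-PROJECTOR `e_{η₁}` on F4's pinned datum `𝓤`
# EXISTS AND IS UNIQUE — the field `e` of a K1ᵘ witness (`GenusDatum.e`, `e_isChiProjector`) is instantiable on
# every `𝒞₇`-frame, from the pins of `CyclotomicSemilocalUnitData` alone (construction, no named fact)

Cell bsd-cm, seat bsd-cm-k-ty1 g24; SUMMON `wake/SUMMON-bsd-cm-k-ty1-20260830T1331Z.md` (b9377bcdb48ad2d0) block (U1)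
«DATUM INFRASTRUCTURE on F4's pinned datum — the projector `e_{η₁} = 12⁻¹ Σ η₁(g)⁻¹ g` as an element/endomorphism
satisfying the frozen `GenusSeven.IsChiProjector`».  Builds on part 1 (`RamifiedSevenGenusTowerAction.lean`: the action
is a representation through the finite quotient `Q`, `#Q ∈ ℤ_pˣ`).  ADDITIVE: the shapes file (B1a; names frozen) and the
oriented file (B2′/B5) are untouched.  HONEST LABEL: infrastructure; K1ᵘ is NOT proved here; no item closes; no stub is
registered; stmt-BirchSwinnertonDyer-19945 is OPEN; `X12.CMRamifiedSeven` is NOT proved; BSD is claimed for no curve.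

## What is proved

* §1 (finite-group algebra) for a finite group `G` acting `Λ`-linearly through `ρ : G →* End_Λ(M)` and a character
  `χ : G →* ℤ_pˣ`: the average `A_χ = Σ_g χ(g)⁻¹ρ(g)` satisfies `ρ(h)A_χ = χ(h)A_χ = A_χρ(h)`, equals `#G` on
  `χ`-eigenvectors, and ANY `e` with the three `IsChiProjector`-type properties satisfies `#G·e = A_χ` (uniqueness).
* §2 on F4's datum `D` over `F₀ = ℚ({x | x^k = a})`, odd `p`, `k < p`, `χ` trivial on the automorphisms fixing the tower:
  the action and `χ` factor through `Q` (`actQuot`, `chiQuot`), `chiProjector D := C(#Q⁻¹) • Σ_{q∈Q} C(χ(q)⁻¹) • act q`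
  satisfies `IsChiProjector D χ` (values in `𝓤^χ`, identity on `𝓤^χ`, `e ∘ act υ = χ(υ)·e`): `isChiProjector_chiProjector`,
  `exists_isChiProjector`; and `IsChiProjector.unique` (two projectors coincide).
* §3 AT THE GENUS FRAME (`p = 7`, `F₀ = ℚ(√D)` by the frame pin `F₀_eq`, `k = 2 < 7`, `η₁` trivial on the tower by
  `η₁_trivial`): ★ `GenusFrame.exists_chiProjector (F) : ∃ e, IsChiProjector F.U F.η₁ e`,
  ★ `GenusFrame.chiProjector_unique`, `GenusFrame.normal_F₀`, `GenusFrame.normal_layer`, and `GenusDatum.e_eq` (two genus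
  data over one frame — for any global families — have the same `e`).

CONSEQUENCE for K1ᵘ (with g23's `x_eq`/`Theta_eq`/`Thetam_eq`, `exists_x`/`exists_Theta(m)`): the fields `e`, `x`, `Θ`,
`Θm` of an `OrientedGenusDatum` are instantiable and unique on every frame; block (U1b) does the pushes `θraw`/`ξraw` from
principal norm-coherent families, the remaining uniqueness, and the typed reduction of the registered stub
`stub_genusFactorisationSeven` to one residual shape.

## References
T. Tsuji, J. Number Theory 78 (1999) §2 Lemma 2.1 (pp. 3–4), §3 (pp. 5–6: `e_χ = (1/#G)Σχ(σ)σ⁻¹`, `U^χ = e_χU`),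
Remark 3 (p. 9) [Tsuji1999]; J.-P. Serre, *A Course in Arithmetic*, Ch. II §3.1 Prop. 7 [Serre1973]; frozen memo
`MEMO-bsd-cm-genus` v1 (a38f3eedd2c92d58) §1 (N4), §7; scope F8 (16530c741a99cc96).
-/

noncomputable section

open scoped NumberField
open PowerSeries IsDedekindDomain Field
open Literature.NumberTheory.EllipticCurves
open Literature.NumberTheory.IwasawaTheory
open Literature.NumberTheory.ComplexMultiplication.EllipticUnits
open Literature.NumberTheory.NumberFields

namespace Summit.BirchSwinnertonDyer.Rank1Residual.Additive.GenusSeven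

/-! ## §1 The `χ`-average and the `χ`-projector of a finite group acting on a `Λ`-module -/

section FiniteGroupProjector

variable {p : ℕ} [Fact p.Prime] {M : Type*} [AddCommGroup M] [Module (IwasawaAlgebra p) M]
  {G : Type*} [Group G] [Fintype G]
  (ρ : G →* Module.End (IwasawaAlgebra p) M) (χ : G →* ℤ_[p]ˣ)

/-- The un-normalised `χ`-average `A_χ = Σ_{g ∈ G} χ(g)⁻¹·ρ(g)` of a finite group `G` acting `Λ`-linearly
(`Λ = ℤ_p⟦T⟧`, constants through `C`); `|G|·e_χ` for Tsuji's idempotent `e_χ = |G|⁻¹Σ χ(σ)σ⁻¹`.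
[cite: Tsuji1999, §3 (p. 6, «e_χ = (1/#G)Σ_{σ∈G} χ(σ)σ⁻¹»)] -/
def chiAverage : M →ₗ[IwasawaAlgebra p] M :=
  ∑ g : G, (C ((χ g⁻¹ : ℤ_[p]ˣ) : ℤ_[p]) : IwasawaAlgebra p) • ρ g

/-- Unfolding `chiAverage` pointwise. [cite: Tsuji1999, §3 (p. 6)] -/
theorem chiAverage_apply (m : M) :
    chiAverage ρ χ m = ∑ g : G, (C ((χ g⁻¹ : ℤ_[p]ˣ) : ℤ_[p]) : IwasawaAlgebra p) • ρ g m := by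
  simp [chiAverage, LinearMap.sum_apply, LinearMap.smul_apply]

omit [Fintype G] in
/-- `ρ(h)·ρ(h⁻¹)·x = x`. [cite: Tsuji1999, §2 (p. 3)] -/
theorem apply_apply_inv (h : G) (x : M) : ρ h (ρ h⁻¹ x) = x := by
  rw [← Module.End.mul_apply, ← map_mul, mul_inv_cancel, map_one, Module.End.one_apply]

omit [Fintype G] in
/-- `ρ(h⁻¹)·ρ(h)·x = x`. [cite: Tsuji1999, §2 (p. 3)] -/
theorem apply_inv_apply (h : G) (x : M) : ρ h⁻¹ (ρ h x) = x := by
  rw [← Module.End.mul_apply, ← map_mul, inv_mul_cancel, map_one, Module.End.one_apply]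

/-- `ρ(h) ∘ A_χ = χ(h)·A_χ` (reindex `g ↦ hg`). [cite: Tsuji1999, §2 Lemma 2.1 (pp. 3–4)] -/
theorem apply_chiAverage (h : G) (m : M) :
    ρ h (chiAverage ρ χ m) = (C ((χ h : ℤ_[p]ˣ) : ℤ_[p]) : IwasawaAlgebra p) • chiAverage ρ χ m := by
  rw [chiAverage_apply, map_sum, Finset.smul_sum, ← Equiv.sum_comp (Equiv.mulLeft h⁻¹)]
  refine Finset.sum_congr rfl fun g _ => ?_
  rw [Equiv.coe_mulLeft, LinearMap.map_smul_of_tower, mul_inv_rev, inv_inv, map_mul, map_mul,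
    Module.End.mul_apply, apply_apply_inv, Units.val_mul, map_mul, mul_comm, mul_smul]

/-- `A_χ ∘ ρ(h) = χ(h)·A_χ` (reindex `g ↦ gh`). [cite: Tsuji1999, §2 Lemma 2.1 (pp. 3–4)] -/
theorem chiAverage_apply_apply (h : G) (m : M) :
    chiAverage ρ χ (ρ h m) = (C ((χ h : ℤ_[p]ˣ) : ℤ_[p]) : IwasawaAlgebra p) • chiAverage ρ χ m := by
  rw [chiAverage_apply, chiAverage_apply, Finset.smul_sum, ← Equiv.sum_comp (Equiv.mulRight h⁻¹)]
  refine Finset.sum_congr rfl fun g _ => ?_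
  rw [Equiv.coe_mulRight, mul_inv_rev, inv_inv, map_mul, map_mul, Module.End.mul_apply,
    apply_inv_apply, Units.val_mul, map_mul, mul_smul]

/-- On a `χ`-eigenvector the average is multiplication by `#G`. [cite: Tsuji1999, §2 Lemma 2.1 (pp. 3–4)] -/
theorem chiAverage_apply_of_forall (m : M)
    (hm : ∀ g : G, ρ g m = (C ((χ g : ℤ_[p]ˣ) : ℤ_[p]) : IwasawaAlgebra p) • m) :
    chiAverage ρ χ m = (Fintype.card G : IwasawaAlgebra p) • m := by
  rw [chiAverage_apply]
  have h1 : ∀ g : G, (C ((χ g⁻¹ : ℤ_[p]ˣ) : ℤ_[p]) : IwasawaAlgebra p) • ρ g m = m := fun g => by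
    rw [hm g, ← mul_smul, ← map_mul, ← Units.val_mul, ← map_mul, inv_mul_cancel, map_one,
      Units.val_one, map_one, one_smul]
  simp_rw [h1, Finset.sum_const, Finset.card_univ, ← Nat.cast_smul_eq_nsmul (IwasawaAlgebra p)]

/-- **Uniqueness of the `χ`-projector**: a `Λ`-linear `e` which is the identity on `χ`-eigenvectors and
satisfies `e ∘ ρ(h) = χ(h)·e`, with values in the `χ`-eigenvectors, satisfies `#G·e = A_χ`.
[cite: Tsuji1999, §2 Lemma 2.1 (pp. 3–4)] -/
theorem card_smul_eq_chiAverage (e : M →ₗ[IwasawaAlgebra p] M)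
    (h₁ : ∀ m : M, ∀ g : G, ρ g (e m) = (C ((χ g : ℤ_[p]ˣ) : ℤ_[p]) : IwasawaAlgebra p) • e m)
    (h₂ : ∀ m : M, (∀ g : G, ρ g m = (C ((χ g : ℤ_[p]ˣ) : ℤ_[p]) : IwasawaAlgebra p) • m) → e m = m)
    (h₃ : ∀ (g : G) (m : M), e (ρ g m) = (C ((χ g : ℤ_[p]ˣ) : ℤ_[p]) : IwasawaAlgebra p) • e m)
    (m : M) : (Fintype.card G : IwasawaAlgebra p) • e m = chiAverage ρ χ m := by
  have hA : e (chiAverage ρ χ m) = (Fintype.card G : IwasawaAlgebra p) • e m := by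
    rw [← chiAverage_apply_of_forall ρ χ (e m) (h₁ m), chiAverage_apply, chiAverage_apply, map_sum]
    refine Finset.sum_congr rfl fun g _ => ?_
    rw [LinearMap.map_smul_of_tower, h₃, h₁]
  rw [← hA]
  refine h₂ _ fun g => ?_
  exact apply_chiAverage ρ χ g m

end FiniteGroupProjector

/-! ## §2 The `χ`-projector `e_χ = #Q⁻¹ Σ_{q ∈ Q} χ(q)⁻¹ q` on F4's pinned datum, and its uniqueness -/

section ChiProjector

variable {p : ℕ} [Fact p.Prime] {v : HeightOneSpectrum (𝓞 ℚ)} {F₀ : IntermediateField ℚ (AlgebraicClosure ℚ)}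
  {γ₀ : absoluteGaloisGroup ℚ}
  (D : CyclotomicSemilocalUnitData p v (cyclotomicLayer F₀ p) (cyclotomicLayer_monotone F₀ p)
    (torsionCyclotomicSubgroup p) γ₀)
  {k : ℕ} {a : ℤ}

/-- `{x | x^k = a}` is the root set of `X^k − a` in `ℚ̄` (`k ≥ 1`). [cite: Tsuji1999, §3 (p. 5)] -/
theorem setOf_pow_eq_intCast_eq_rootSet (hk : 0 < k) (a : ℤ) :
    {x : AlgebraicClosure ℚ | x ^ k = (a : AlgebraicClosure ℚ)} =
      ((Polynomial.X ^ k - Polynomial.C (a : ℚ) : Polynomial ℚ).rootSet (AlgebraicClosure ℚ)) := by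
  ext x
  have hne : (Polynomial.X ^ k - Polynomial.C (a : ℚ) : Polynomial ℚ) ≠ 0 := Polynomial.X_pow_sub_C_ne_zero hk _
  rw [Set.mem_setOf_eq, Polynomial.mem_rootSet_of_ne hne, map_sub, map_pow, Polynomial.aeval_X,
    Polynomial.aeval_C, map_intCast, sub_eq_zero]

/-- **`F₀ = ℚ({x | x^k = a})` is normal over `ℚ`** (a splitting field of `X^k − a`; for the genus frame `k = 2`,
`a = D`, `F₀ = ℚ(√D)`). [cite: Tsuji1999, §3 (p. 5, «F a finite abelian extension of ℚ»)] -/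
theorem normal_of_eq_adjoin_pow (hk : 0 < k)
    (hF₀ : F₀ = IntermediateField.adjoin ℚ {x : AlgebraicClosure ℚ | x ^ k = (a : AlgebraicClosure ℚ)}) :
    Normal ℚ F₀ := by
  rw [hF₀, setOf_pow_eq_intCast_eq_rootSet hk]
  set P : Polynomial ℚ := Polynomial.X ^ k - Polynomial.C (a : ℚ)
  haveI hP := IntermediateField.adjoin_rootSet_isSplittingField
    (IsAlgClosed.splits (P.map (algebraMap ℚ (AlgebraicClosure ℚ))))
  exact Normal.of_isSplittingField (hFEp := hP)

section
variable (hk : 0 < k)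
  (hF₀ : F₀ = IntermediateField.adjoin ℚ {x : AlgebraicClosure ℚ | x ^ k = (a : AlgebraicClosure ℚ)})
  (χ : torsionCyclotomicSubgroup p →* ℤ_[p]ˣ)
  (hχ : ∀ σ : torsionCyclotomicSubgroup p,
    (∀ n, (σ : absoluteGaloisGroup ℚ) ∈ fixingSubgroupQ (cyclotomicLayer F₀ p n)) → χ σ = 1)

include hF₀ in
/-- The kernel of `towerHom` acts trivially on `𝓤`. [cite: Tsuji1999, §3 (p. 6)] -/
theorem towerHom_ker_le_ker_actHom :
    (towerHom p k a).ker ≤ (CyclotomicAction.actHom D (normal_of_eq_adjoin_pow hk hF₀)).ker := fun υ hυ => by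
  rw [MonoidHom.mem_ker] at hυ ⊢
  rw [CyclotomicAction.actHom_apply, Module.End.one_eq_id]
  exact LinearMap.ext fun m => CyclotomicAction.act_apply_eq_self_of_forall_fixed D υ
    (smul_eq_self_of_towerHom_eq_one p F₀ k a hF₀ υ hυ) m

include hF₀ hχ in
/-- The kernel of `towerHom` lies in the kernel of `χ` (a character of `G = Gal(K_∞/B_∞)`). [cite: Tsuji1999, §3 (p. 6)] -/
theorem towerHom_ker_le_ker_chi : (towerHom p k a).ker ≤ χ.ker := fun υ hυ => by
  rw [MonoidHom.mem_ker] at hυ ⊢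
  exact hχ υ (mem_fixingSubgroupQ_of_towerHom_eq_one p F₀ k a hF₀ υ hυ)

/-- **The action of `Q = Υ ⧸ ker(towerHom)` on `𝓤`** (the finite group through which `Υ` acts).
[cite: Tsuji1999, §3 (p. 6, «modules over ℤ_p[G]⟦Γ⟧»)] -/
def actQuot : torsionCyclotomicSubgroup p ⧸ (towerHom p k a).ker →* Module.End (IwasawaAlgebra p) D.M :=
  QuotientGroup.lift _ (CyclotomicAction.actHom D (normal_of_eq_adjoin_pow hk hF₀))
    (towerHom_ker_le_ker_actHom D hk hF₀)

/-- `actQuot` on a class is `act` of a representative. [cite: Tsuji1999, §3 (p. 6)] -/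
@[simp] theorem actQuot_mk (υ : torsionCyclotomicSubgroup p) :
    actQuot D hk hF₀ (υ : torsionCyclotomicSubgroup p ⧸ (towerHom p k a).ker) = D.act υ := by
  rw [actQuot, QuotientGroup.lift_mk, CyclotomicAction.actHom_apply]

/-- **The character `χ` read on `Q`.** [cite: Tsuji1999, §3 (p. 6, «χ a character of G»)] -/
def chiQuot : torsionCyclotomicSubgroup p ⧸ (towerHom p k a).ker →* ℤ_[p]ˣ :=
  QuotientGroup.lift _ χ (towerHom_ker_le_ker_chi hF₀ χ hχ)

/-- `chiQuot` on a class is `χ` of a representative. [cite: Tsuji1999, §3 (p. 6)] -/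
@[simp] theorem chiQuot_mk (υ : torsionCyclotomicSubgroup p) :
    chiQuot hF₀ χ hχ (υ : torsionCyclotomicSubgroup p ⧸ (towerHom p k a).ker) = χ υ := by
  rw [chiQuot, QuotientGroup.lift_mk]

end

variable (p k a) in
/-- A `Fintype` structure on the finite quotient `Q` (explicit, so that no instance is declared).
[cite: Tsuji1999, §3 (p. 6)] -/
@[reducible] def fintypeTowerQuot (hk : 0 < k) : Fintype (torsionCyclotomicSubgroup p ⧸ (towerHom p k a).ker) :=
  haveI := finite_towerQuot p k a hk
  Fintype.ofFinite _

section
variable (hk : 0 < k)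
  (hF₀ : F₀ = IntermediateField.adjoin ℚ {x : AlgebraicClosure ℚ | x ^ k = (a : AlgebraicClosure ℚ)})
  (χ : torsionCyclotomicSubgroup p →* ℤ_[p]ˣ)
  (hχ : ∀ σ : torsionCyclotomicSubgroup p,
    (∀ n, (σ : absoluteGaloisGroup ℚ) ∈ fixingSubgroupQ (cyclotomicLayer F₀ p n)) → χ σ = 1)

/-- **The `χ`-projector `e_χ = #Q⁻¹ · Σ_{q ∈ Q} χ(q)⁻¹·q` on `𝓤`** (Tsuji's `e_χ = (1/#G)Σ χ(σ)σ⁻¹` summed over the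
image `Q` of `Υ`; `#Q ∈ ℤ_pˣ` when `p` is odd and `k < p`). [cite: Tsuji1999, §3 (p. 6, «e_χ = (1/#G)Σ_{σ∈G} χ(σ)σ⁻¹», «U^χ = e_χU»)] -/
def chiProjector : D.M →ₗ[IwasawaAlgebra p] D.M :=
  (C (Ring.inverse ((Nat.card (torsionCyclotomicSubgroup p ⧸ (towerHom p k a).ker) : ℕ) : ℤ_[p])) :
      IwasawaAlgebra p) •
    @chiAverage p _ D.M _ _ _ _ (fintypeTowerQuot p k a hk) (actQuot D hk hF₀) (chiQuot hF₀ χ hχ)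

/-- The `χ`-part read on `Q`: `m ∈ 𝓤^χ` iff `q·m = χ(q)m` for all `q ∈ Q`. [cite: Tsuji1999, §2 Lemma 2.1 (pp. 3–4)] -/
theorem mem_chiPart_iff_forall_quot (m : D.M) :
    m ∈ D.chiPart χ ↔ ∀ q : torsionCyclotomicSubgroup p ⧸ (towerHom p k a).ker,
      actQuot D hk hF₀ q m = (C ((chiQuot hF₀ χ hχ q : ℤ_[p]ˣ) : ℤ_[p]) : IwasawaAlgebra p) • m := by
  rw [CyclotomicSemilocalUnitData.mem_chiPart_iff]
  constructor
  · intro h q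
    obtain ⟨υ, rfl⟩ := QuotientGroup.mk_surjective q
    rw [actQuot_mk, chiQuot_mk]
    exact h υ
  · intro h υ
    have := h υ
    rwa [actQuot_mk, chiQuot_mk] at this

include hk in
/-- `C(#Q⁻¹) · #Q = 1` in `Λ` (odd `p`, `k < p`). [cite: Tsuji1999, §3 (p. 6)] -/
theorem C_inverse_card_mul_card (hp : p ≠ 2) (hkp : k < p)
    (inst : Fintype (torsionCyclotomicSubgroup p ⧸ (towerHom p k a).ker)) :
    (C (Ring.inverse ((Nat.card (torsionCyclotomicSubgroup p ⧸ (towerHom p k a).ker) : ℕ) : ℤ_[p])) :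
      IwasawaAlgebra p) *
        (@Fintype.card (torsionCyclotomicSubgroup p ⧸ (towerHom p k a).ker) inst : IwasawaAlgebra p) = 1 := by
  rw [← @Nat.card_eq_fintype_card _ inst, ← map_natCast C, ← map_mul,
    Ring.inverse_mul_cancel _ (isUnit_card_towerQuot p k a hp hk hkp), map_one]

/-- **`chiProjector` IS the `χ`-projector: values in `𝓤^χ`, identity on `𝓤^χ`, `e ∘ υ = χ(υ)·e`** — for odd `p`
and `k < p`. [cite: Tsuji1999, §2 Lemma 2.1 (pp. 3–4) and §3 (p. 6, «U^χ = e_χU»)] -/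
theorem isChiProjector_chiProjector (hp : p ≠ 2) (hkp : k < p) :
    IsChiProjector D χ (chiProjector D hk hF₀ χ hχ) := by
  letI := fintypeTowerQuot p k a hk
  have hcard := C_inverse_card_mul_card (a := a) hk hp hkp (fintypeTowerQuot p k a hk)
  refine ⟨fun m => ?_, fun m hm => ?_, fun υ m => ?_⟩
  · rw [mem_chiPart_iff_forall_quot D hk hF₀ χ hχ]
    intro q
    show actQuot D hk hF₀ q ((C _ : IwasawaAlgebra p) • chiAverage (actQuot D hk hF₀) (chiQuot hF₀ χ hχ) m) = _
    rw [map_smul, apply_chiAverage, smul_comm]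
    rfl
  · rw [mem_chiPart_iff_forall_quot D hk hF₀ χ hχ] at hm
    show (C _ : IwasawaAlgebra p) • chiAverage (actQuot D hk hF₀) (chiQuot hF₀ χ hχ) m = m
    rw [chiAverage_apply_of_forall _ _ m hm, ← mul_smul, hcard, one_smul]
  · show (C _ : IwasawaAlgebra p) • chiAverage (actQuot D hk hF₀) (chiQuot hF₀ χ hχ) (D.act υ m) = _
    rw [← actQuot_mk D hk hF₀ υ, chiAverage_apply_apply, smul_comm, chiQuot_mk]
    rfl

include hk hF₀ hχ in
/-- **EXISTENCE of the `χ`-projector on every pinned datum of `𝓤`** (odd `p`, `F₀ = ℚ({x | x^k = a})`, `k < p`,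
`χ` trivial on the automorphisms fixing the tower). [cite: Tsuji1999, §3 (p. 6, «U^χ = e_χU»)] -/
theorem exists_isChiProjector (hp : p ≠ 2) (hkp : k < p) :
    ∃ e : D.M →ₗ[IwasawaAlgebra p] D.M, IsChiProjector D χ e :=
  ⟨chiProjector D hk hF₀ χ hχ, isChiProjector_chiProjector D hk hF₀ χ hχ hp hkp⟩

/-- **The projector preserves every `Υ`-stable `Λ`-submodule** (e.g. `𝒞`, once `𝒞` is known to be `Υ`-stable): `e_χ m`
is a `Λ`-combination of the translates `q·m`. [cite: Tsuji1999, §3 (p. 6, «𝒞^χ», «the functor M ↦ M^ψ»)] -/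
theorem chiProjector_apply_mem (N : Submodule (IwasawaAlgebra p) D.M)
    (hN : ∀ (υ : torsionCyclotomicSubgroup p) (m : D.M), m ∈ N → D.act υ m ∈ N) {m : D.M} (hm : m ∈ N) :
    chiProjector D hk hF₀ χ hχ m ∈ N := by
  letI := fintypeTowerQuot p k a hk
  refine N.smul_mem _ ?_
  rw [chiAverage_apply]
  refine Submodule.sum_mem _ fun q _ => N.smul_mem _ ?_
  obtain ⟨υ, rfl⟩ := QuotientGroup.mk_surjective q
  rw [actQuot_mk]
  exact hN υ m hm

include hk hF₀ hχ in
/-- **UNIQUENESS of the `χ`-projector**: `IsChiProjector` determines `e` (`#Q·e = Σ χ(q)⁻¹q`, `#Q ∈ ℤ_pˣ`).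
[cite: Tsuji1999, §2 Lemma 2.1 (pp. 3–4)] -/
theorem IsChiProjector.unique (hp : p ≠ 2) (hkp : k < p) {e e' : D.M →ₗ[IwasawaAlgebra p] D.M}
    (he : IsChiProjector D χ e) (he' : IsChiProjector D χ e') : e = e' := by
  letI := fintypeTowerQuot p k a hk
  have key : ∀ {f : D.M →ₗ[IwasawaAlgebra p] D.M}, IsChiProjector D χ f → ∀ m,
      (Fintype.card (torsionCyclotomicSubgroup p ⧸ (towerHom p k a).ker) : IwasawaAlgebra p) • f m =
        chiAverage (actQuot D hk hF₀) (chiQuot hF₀ χ hχ) m := by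
    intro f hf m
    refine card_smul_eq_chiAverage _ _ f (fun m q => ?_) (fun m hm => hf.2.1 m ?_) (fun q m => ?_) m
    · exact (mem_chiPart_iff_forall_quot D hk hF₀ χ hχ (f m)).mp (hf.1 m) q
    · exact (mem_chiPart_iff_forall_quot D hk hF₀ χ hχ m).mpr hm
    · obtain ⟨υ, rfl⟩ := QuotientGroup.mk_surjective q
      rw [actQuot_mk, chiQuot_mk]
      exact hf.2.2 υ m
  have hcard := C_inverse_card_mul_card (a := a) hk hp hkp (fintypeTowerQuot p k a hk)
  ext m
  have h1 := congrArg ((C (Ring.inverse ((Nat.card (torsionCyclotomicSubgroup p ⧸ (towerHom p k a).ker) : ℕ) :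
    ℤ_[p])) : IwasawaAlgebra p) • ·) ((key he m).trans (key he' m).symm)
  simp only [← mul_smul, hcard, one_smul] at h1
  exact h1

end

end ChiProjector

/-! ## §3 The genus frame: `e_{η₁}` EXISTS AND IS UNIQUE on F4's pinned datum `F.U` -/

namespace GenusFrame

variable (F : GenusFrame)

/-- `F₀ = ℚ(√D)` is normal over `ℚ`. [cite: Tsuji1999, §3 (p. 5, «F a finite abelian extension of ℚ»)] -/
theorem normal_F₀ : Normal ℚ F.F₀ := normal_of_eq_adjoin_pow (k := 2) (a := F.D) two_pos F.F₀_eq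

/-- Every layer `K_n = ℚ(ζ_{7^{n+1}}, √D)` of the genus tower is normal over `ℚ`.
[cite: Tsuji1999, §3 (p. 6, L1–5)] -/
theorem normal_layer (n : ℕ) : Normal ℚ (F.layer n) := normal_cyclotomicLayer F.F₀ 7 F.normal_F₀ n

/-- **The `η₁`-projector EXISTS on the frame's pinned datum `𝓤`**: `e_{η₁} = #Q⁻¹Σ_{q∈Q} η₁(q)⁻¹q`, `Q` the image of
`Υ = Gal(ℚ̄/B_∞)` acting on the tower (`#Q ∣ 2·#μ₆(ℤ₇)`, a `7`-adic unit).  The field `e` of a `GenusDatum` is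
thereby instantiable. [cite: Tsuji1999, §3 (p. 6, «U^χ = e_χU»)] -/
theorem exists_chiProjector : ∃ e : F.U.M →ₗ[IwasawaAlgebra 7] F.U.M, IsChiProjector F.U F.η₁ e :=
  exists_isChiProjector F.U two_pos F.F₀_eq F.η₁ F.η₁_trivial (by decide) (by decide)

/-- **… and `IsChiProjector` pins it uniquely**: two `η₁`-projectors on `F.U` coincide; hence the fields `e`, and with
them `θ = e θraw`, `ξ = e ξraw`, of any two genus data over the same frame agree. [cite: Tsuji1999, §2 Lemma 2.1 (pp. 3–4)] -/
theorem chiProjector_unique {e e' : F.U.M →ₗ[IwasawaAlgebra 7] F.U.M} (he : IsChiProjector F.U F.η₁ e)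
    (he' : IsChiProjector F.U F.η₁ e') : e = e' :=
  IsChiProjector.unique F.U two_pos F.F₀_eq F.η₁ F.η₁_trivial (by decide) (by decide) he he'

/-- **Any `η₁`-projector on `F.U` preserves every `Υ`-stable `Λ`-submodule** (by uniqueness it IS `#Q⁻¹Σ η₁(q)⁻¹q`); used
with `N = 𝒞`: `e_{η₁}ξ ∈ 𝒞` as soon as `𝒞` is `Υ`-stable. [cite: Tsuji1999, §3 (p. 6, «𝒞^χ = e_χ𝒞»)] -/
theorem chiProjector_apply_mem_of_stable {e : F.U.M →ₗ[IwasawaAlgebra 7] F.U.M} (he : IsChiProjector F.U F.η₁ e)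
    (N : Submodule (IwasawaAlgebra 7) F.U.M)
    (hN : ∀ (υ : torsionCyclotomicSubgroup 7) (m : F.U.M), m ∈ N → F.U.act υ m ∈ N) {m : F.U.M} (hm : m ∈ N) :
    e m ∈ N := by
  rw [F.chiProjector_unique he
    (isChiProjector_chiProjector F.U two_pos F.F₀_eq F.η₁ F.η₁_trivial (by decide) (by decide))]
  exact chiProjector_apply_mem F.U two_pos F.F₀_eq F.η₁ F.η₁_trivial N hN hm

end GenusFrame

/-- Two genus data over the same frame have the same projector `e`. [cite: Tsuji1999, §2 Lemma 2.1 (pp. 3–4)] -/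
theorem GenusDatum.e_eq {F : GenusFrame} {θu θu' : ∀ n : ℕ, globalUnitsOf (F.layer n)} (d : GenusDatum F θu)
    (d' : GenusDatum F θu') : d.e = d'.e :=
  F.chiProjector_unique d.e_isChiProjector d'.e_isChiProjector




end Summit.BirchSwinnertonDyer.Rank1Residual.Additive.GenusSeven

end
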